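import Summits.CriticalPhenomena.PercolationContinuityZ3.Theorems.Transplant.TwoAxisParaCellsSkel
import Summits.CriticalPhenomena.PercolationContinuityZ3.Theorems.Transplant.SkelNegParamsScales
import HarnessLib

/-!
# N1 params, part 0b (q-free arithmetic): the ρ-LIPSCHITZ ADMISSIBILITY and the COARSE READING OF KIT DRIFT discharged from the ledger's floors —
# the hypotheses `hL0/hL1` of hp-8's `Skelφ.lip_coarseSkel` / `coarse_containment` (TwoAxisParaCellsSkel, p266580) at `A = 800`, `c = 20K` follow from
# the four `EquilibriumAt` inequalities at the long scale and `K·(s+2) ≤ M_L` (`s = 1`: ρ-Lip; `s = R′`: a kit's `R′`-displacement reads as one ρ-unit)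

builds on p205010 (kernel theorem, internal audit signed; external expert review pending) — nothing in this file uses p205010.
Status sentence (coordinator 2026-08-20T04:30Z): "θ(p_c) = 0 on ℤ^d, all d ≥ 2 — kernel-verified (Lean 4/Mathlib, standard axioms); internal adversarial
audit SIGNED 2026-08-20 04:29Z; external expert review pending."
Lane `prim-bschramm-*`, seat `prim-bschramm-stmt` (gen 11); helper file (`--supports stmt-CriticalPhenomena-4575 --as helper`); ledger HOME/prim-bschramm-stmt/NEG-PARAMS.md
v0.2 (n5)(iii)(iv), 1H `rhoLip_at`, §9 Q4 (`c_R′ = 1`); NEG-CHECKLIST N3b (ii) ("the two Lipschitz constants … and the admissibility … are DISCHARGED from MT17-L3.5's output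
ranges — one arithmetic lemma").  INPUTS (names of the landed files): `TwoAxis.Para.modulus n h vα vβ = n·vβ − h·vα`, `TwoAxis.Para.detD A n h vα vβ = A²·modulus` (p266166);
the long-scale facts of `Skelφ.EquilibriumAt` (p265235): `M < n`, `M < ℓ`, `(M+1)(n+|h|) ≤ n(ℓ+1)`; the top-layer constraint of the split point `v = (vα, vβ)` (hp-8 C1 / §10.1):
`|vα| ≤ n`, `nℓ − (n+|h|) < modulus ≤ nℓ`; the ledger floor `K(s+2) ≤ M` (`Skelφ.NegPrm.coarse_floor_le_ML`, p266523, gives `K(R′+2) ≤ M_L`).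
* §1 `NegPrm.core_adm`: `0 ≤ K, 0 ≤ s, K·s + 2 ≤ M, M+1 ≤ n, M+1 ≤ ℓ, (M+1)(n+a) ≤ n(ℓ+1) ⊢ K·s·(n+a) ≤ 40·(nℓ − n − a)`; `NegPrm.core_adm_ℓ`: same ⊢ `K·s·ℓ ≤ 40·(nℓ − n − a)`;
  `NegPrm.abs_vβ_le`: `0 < n, 0 ≤ ℓ, |vα| ≤ n, nℓ − (n+|h|) < modulus ≤ nℓ ⊢ |vβ| ≤ ℓ + 2|h| + 1`;
* §2 THE DISCHARGES at `A = 800`, `c = 20·K`: **`NegPrm.hL1_of_floors`** (`20K·(|800|·(|n|+|h|))·s ≤ 1·detD 800 n h vα vβ` from `K·s + 2 ≤ M`), **`NegPrm.hL0_of_floors`**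
  (`20K·(|800|·(|vβ|+|vα|))·s ≤ 1·detD …` from `4K·s + 2 ≤ M`, via `|vβ| + |vα| ≤ n + ℓ + 2|h| + 1`); corollaries `lip_coarseSkel_of_floors` (ρ-Lip, `s = 1`) and `coarse_containment_of_floors` (`k = 1` for a
  planar displacement `≤ s`, e.g. `s = R′`).
[cite: MartineauTassion2017, §4.1 (the cell lattice; det(u,v) = nℓ up to the layer)] [cite: KozmaNitzan2024, §4 Theorem 6 (order of constants)]
-/

namespace Summit.CriticalPhenomena.PercolationContinuityZ3.Theorems.Transplant

namespace Skelφ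

namespace NegPrm

open Literature.Probability.LatticeModels TwoAxis.Para

/-! ## §1 The integer inequalities -/

/-- **Core admissibility inequality**: from the long-scale `EquilibriumAt` facts `M+1 ≤ n`, `M+1 ≤ ℓ`, `(M+1)(n+a) ≤ n(ℓ+1)` (`a = |h|`) and the ledger floor
`K·s + 2 ≤ M`: `K·s·(n + a) ≤ 40·(nℓ − n − a)` (`a ≥ 0` is not even needed).  Proof: multiply by `M+1`; `(M+1)(nℓ − n − a) ≥ n(Mℓ − 1)` from the layer inequality; `K s (ℓ+1) ≤ 40(Mℓ − 1)`
from `M ≥ Ks + 2`, `ℓ ≥ 1`. [this work] -/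
theorem core_adm {K s M n ℓ a : ℤ} (hK : 0 ≤ K) (hs : 0 ≤ s) (hM : K * s + 2 ≤ M) (hn : M + 1 ≤ n) (hℓ : M + 1 ≤ ℓ)
    (hlay : (M + 1) * (n + a) ≤ n * (ℓ + 1)) : K * s * (n + a) ≤ 40 * (n * ℓ - n - a) := by
  have hKs : 0 ≤ K * s := mul_nonneg hK hs
  have hM0 : 0 < M + 1 := by linarith
  have hn0 : 0 ≤ n := by linarith
  -- (1) multiply the layer inequality by `K s`
  have h1 : K * s * (n + a) * (M + 1) ≤ K * s * (n * (ℓ + 1)) := by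
    have := mul_le_mul_of_nonneg_left hlay hKs
    nlinarith [this]
  -- (2) the layer inequality bounds `(M+1)a`, whence `(M+1)(nℓ − n − a) ≥ n(Mℓ − 1)`
  have h2 : n * (M * ℓ - 1) ≤ (M + 1) * (n * ℓ - n - a) := by nlinarith [hlay]
  -- (3) `K s (ℓ+1) ≤ 40 (Mℓ − 1)` from `M ≥ Ks + 2`, `ℓ ≥ 1`
  have h3 : K * s * (ℓ + 1) ≤ 40 * (M * ℓ - 1) := by
    have e1 : 0 ≤ (M - (K * s + 2)) * ℓ := mul_nonneg (by linarith) (by linarith)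
    have e2 : 0 ≤ K * s * (ℓ - 1) := mul_nonneg hKs (by linarith)
    nlinarith [e1, e2]
  -- (4) multiply (3) by `n ≥ 0` and chain
  have h4 : K * s * (n * (ℓ + 1)) ≤ 40 * (n * (M * ℓ - 1)) := by
    have := mul_le_mul_of_nonneg_left h3 hn0
    nlinarith [this]
  have h5 : K * s * (n + a) * (M + 1) ≤ 40 * (n * ℓ - n - a) * (M + 1) := by
    calc K * s * (n + a) * (M + 1) ≤ K * s * (n * (ℓ + 1)) := h1
      _ ≤ 40 * (n * (M * ℓ - 1)) := h4
      _ ≤ 40 * ((M + 1) * (n * ℓ - n - a)) := by nlinarith [h2]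
      _ = 40 * (n * ℓ - n - a) * (M + 1) := by ring
  exact le_of_mul_le_mul_right h5 hM0

/-- **Core inequality for the height term**: under the same hypotheses, `K·s·ℓ ≤ 40·(nℓ − n − a)` (uses `n ≥ M + 1 ≥ K s + 3`). [this work] -/
theorem core_adm_ℓ {K s M n ℓ a : ℤ} (hK : 0 ≤ K) (hs : 0 ≤ s) (hM : K * s + 2 ≤ M) (hn : M + 1 ≤ n) (hℓ : M + 1 ≤ ℓ)
    (hlay : (M + 1) * (n + a) ≤ n * (ℓ + 1)) : K * s * ℓ ≤ 40 * (n * ℓ - n - a) := by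
  have hKs : 0 ≤ K * s := mul_nonneg hK hs
  have hM0 : 0 < M + 1 := by linarith
  have h2 : n * (M * ℓ - 1) ≤ (M + 1) * (n * ℓ - n - a) := by nlinarith [hlay]
  -- `K s ℓ (M+1) ≤ 40 n (Mℓ − 1)`: `K s ≤ M`, `M+1 ≤ n`, and `ℓ·M·... `
  have h3 : K * s * ℓ * (M + 1) ≤ 40 * (n * (M * ℓ - 1)) := by
    have e1 : 0 ≤ (n - (M + 1)) * (M * ℓ - 1) := mul_nonneg (by linarith) (by nlinarith)
    have e2 : 0 ≤ (M - K * s) * ℓ := mul_nonneg (by linarith) (by linarith)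
    have e3 : 0 ≤ K * s * ℓ := mul_nonneg hKs (by linarith)
    have e4 : (1 : ℤ) ≤ M * ℓ - 1 := by nlinarith
    nlinarith [e1, e2, e3, e4, mul_nonneg hKs (by linarith : (0 : ℤ) ≤ M)]
  have h5 : K * s * ℓ * (M + 1) ≤ 40 * (n * ℓ - n - a) * (M + 1) := by
    calc K * s * ℓ * (M + 1) ≤ 40 * (n * (M * ℓ - 1)) := h3
      _ ≤ 40 * ((M + 1) * (n * ℓ - n - a)) := by nlinarith [h2]
      _ = 40 * (n * ℓ - n - a) * (M + 1) := by ring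
  exact le_of_mul_le_mul_right h5 hM0

/-- **The split point's second coordinate**: `|vα| ≤ n` and the top-layer constraint `nℓ − (n + |h|) < n·vβ − h·vα ≤ nℓ` give `|vβ| ≤ ℓ + 2|h| + 1` (`n > 0`;
upper bound `ℓ + |h|`, lower bound `−(|h| + 1) − |h|`). [folklore] -/
theorem abs_vβ_le {n h ℓ vα vβ : ℤ} (hn : 0 < n) (hℓ : 0 ≤ ℓ) (hv : |vα| ≤ n)
    (hlay : n * ℓ - (n + |h|) < modulus n h vα vβ ∧ modulus n h vα vβ ≤ n * ℓ) : |vβ| ≤ ℓ + 2 * |h| + 1 := by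
  unfold modulus at hlay
  obtain ⟨h1, h2⟩ := hlay
  have hhv : |h * vα| ≤ |h| * n := by rw [abs_mul]; exact mul_le_mul_of_nonneg_left hv (abs_nonneg _)
  have hb := abs_le.1 hhv
  have h0 : 0 ≤ |h| := abs_nonneg h
  rw [abs_le]
  constructor
  · by_contra hc
    push Not at hc
    -- `vβ ≤ −(ℓ + 2|h| + 1) − 1`, so `n vβ ≤ −n(ℓ + 2|h| + 2)`; but `n vβ > nℓ − n − |h| − |h| n`
    have hc' : vβ + (ℓ + 2 * |h| + 2) ≤ 0 := by linarith
    have : n * (vβ + (ℓ + 2 * |h| + 2)) ≤ 0 := mul_nonpos_of_nonneg_of_nonpos hn.le hc'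
    nlinarith [hb.1, hb.2, mul_nonneg hn.le hℓ, mul_nonneg hn.le h0]
  · by_contra hc
    push Not at hc
    have hc' : ℓ + |h| + 1 ≤ vβ := by linarith
    have : n * (ℓ + |h| + 1) ≤ n * vβ := mul_le_mul_of_nonneg_left hc' hn.le
    nlinarith [hb.1, hb.2]

/-! ## §2 The discharges at `A = 800`, `c = 20·K` -/

/-- **`hL1` from the floors** (sheared-height coordinate, `L₁ = A(n + |h|)`): with `K·s + 2 ≤ M` and the long-scale `EquilibriumAt` facts,
`20K·(|800|·(|n| + |h|))·s ≤ detD 800 n h vα vβ` — for `s = 1` this is `lip_coarseSkel`'s `hL1`, for `s = R′` it is `coarse_containment`'s `hL1` with `k = 1`.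
[this work] -/
theorem hL1_of_floors {K s M : ℤ} {n ℓ : ℕ} {h vα vβ : ℤ} (hK : 0 ≤ K) (hs : 0 ≤ s) (hM : K * s + 2 ≤ M) (hn : M + 1 ≤ n) (hℓ : M + 1 ≤ ℓ)
    (hlay₁ : (M + 1) * ((n : ℤ) + |h|) ≤ (n : ℤ) * ((ℓ : ℤ) + 1))
    (hlay : (n : ℤ) * ℓ - (n + |h|) < modulus n h vα vβ ∧ modulus n h vα vβ ≤ n * ℓ) :
    20 * K * (|(800 : ℤ)| * (|(n : ℤ)| + |h|) * s) ≤ 1 * detD 800 n h vα vβ := by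
  have hcore := core_adm hK hs hM hn hℓ hlay₁
  rw [one_mul, detD, abs_of_nonneg (by norm_num : (0 : ℤ) ≤ 800), abs_of_nonneg (by positivity : (0 : ℤ) ≤ (n : ℤ))]
  nlinarith [hlay.1, hcore]

/-- **`hL0` from the floors** (along-`u` coordinate, `L₀ = A(|vβ| + |vα|) ≤ A(n + ℓ + 2|h| + 1)`): with the stronger floor `4·K·s + 2 ≤ M`,
`20K·(|800|·(|vβ| + |vα|))·s ≤ detD 800 n h vα vβ`. [this work] -/
theorem hL0_of_floors {K s M : ℤ} {n ℓ : ℕ} {h vα vβ : ℤ} (hK : 0 ≤ K) (hs : 0 ≤ s) (hM : 4 * K * s + 2 ≤ M) (hn : M + 1 ≤ n) (hℓ : M + 1 ≤ ℓ)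
    (hlay₁ : (M + 1) * ((n : ℤ) + |h|) ≤ (n : ℤ) * ((ℓ : ℤ) + 1)) (hv : |vα| ≤ (n : ℤ))
    (hlay : (n : ℤ) * ℓ - (n + |h|) < modulus n h vα vβ ∧ modulus n h vα vβ ≤ n * ℓ) :
    20 * K * (|(800 : ℤ)| * (|vβ| + |vα|) * s) ≤ 1 * detD 800 n h vα vβ := by
  have hK4 : 0 ≤ 4 * K := by linarith
  have hM' : (4 * K) * s + 2 ≤ M := by linarith
  -- both pieces at strength `4K`: `(n + |h|)`-part and `ℓ`-part, each `≤ 40(nℓ − n − |h|)` with `K ↦ 4K`, i.e. `≤ 10(…)` per `K`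
  have hcore := core_adm hK4 hs hM' hn hℓ hlay₁
  have hcoreℓ := core_adm_ℓ hK4 hs hM' hn hℓ hlay₁
  have hn0 : (0 : ℤ) < n := by linarith [mul_nonneg hK4 hs]
  have hvβ := abs_vβ_le hn0 (by positivity) hv hlay
  rw [one_mul, detD, abs_of_nonneg (by norm_num : (0 : ℤ) ≤ 800)]
  have hsum : |vβ| + |vα| ≤ (n : ℤ) + ℓ + 2 * |h| + 1 := by linarith
  have hKs : 0 ≤ K * s := mul_nonneg hK hs
  have hstep : 20 * K * (800 * (|vβ| + |vα|) * s) ≤ 20 * K * (800 * ((n : ℤ) + ℓ + 2 * |h| + 1) * s) := by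
    have e : 0 ≤ 20 * K * 800 * s * (((n : ℤ) + ℓ + 2 * |h| + 1) - (|vβ| + |vα|)) :=
      mul_nonneg (by positivity) (by linarith)
    nlinarith [e]
  refine hstep.trans ?_
  have e1 : 0 ≤ K * s * ((n : ℤ) - 1) := mul_nonneg hKs (by linarith)
  have e2 : 0 ≤ 4 * K * s * ((n : ℤ) + |h|) := by positivity
  nlinarith [hlay.1, hcore, hcoreℓ, e1, e2]

variable {V : Type} {G : SimpleGraph V} {φ : V → Site 2}

/-- **ρ-Lip from the floors**: the coarse skeleton of the long cell lattice (`A = 800`, `c = 20K`) is 1-Lipschitz as soon as `4K + 2 ≤ M_L` and the long-scale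
`EquilibriumAt` / top-layer facts hold — the instance of hp-8's `lip_coarseSkel` the ledger uses (NEG-PARAMS 1H `rhoLip_at`). [this work] -/
theorem lip_coarseSkel_of_floors (hlip : Lip G φ) (t : V) {K M : ℤ} {n ℓ : ℕ} {h vα vβ s₀ s₁ : ℤ} (hK : 0 ≤ K) (hM : 4 * K + 2 ≤ M)
    (hn : M + 1 ≤ n) (hℓ : M + 1 ≤ ℓ) (hlay₁ : (M + 1) * ((n : ℤ) + |h|) ≤ (n : ℤ) * ((ℓ : ℤ) + 1)) (hv : |vα| ≤ (n : ℤ))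
    (hlay : (n : ℤ) * ℓ - (n + |h|) < modulus n h vα vβ ∧ modulus n h vα vβ ≤ n * ℓ) :
    Lip G (coarseSkel φ t 800 n h vα vβ (20 * K) s₀ s₁ (detD 800 n h vα vβ)) := by
  have hD : 0 < detD 800 n h vα vβ := by
    rw [detD]
    have : (0 : ℤ) < modulus n h vα vβ := by
      have hM1 : (M + 1) * ((n : ℤ) + |h|) ≤ (n : ℤ) * ((ℓ : ℤ) + 1) := hlay₁
      nlinarith [hlay.1, abs_nonneg h, hM, hK]
    positivity
  have h1 := hL1_of_floors (s := 1) hK zero_le_one (by linarith) hn hℓ hlay₁ hlay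
  have h0 := hL0_of_floors (s := 1) hK zero_le_one (by linarith) hn hℓ hlay₁ hv hlay
  rw [mul_one, one_mul] at h1 h0
  exact lip_coarseSkel hlip t (by linarith) hD h0 h1

/-- **COARSE READING OF A KIT DISPLACEMENT** (`c_R′ = 1`): two vertices at planar distance `≤ s` (e.g. `s = R′`, a kit's level displacement) have coarse positions at
distance `≤ 1` in each coordinate, as soon as `4K·s + 2 ≤ M_L` — the instance of hp-8's `coarse_containment` with `k = 1` (NEG-PARAMS (n5)(iii), (n9)). [this work] -/
theorem coarse_containment_of_floors (t : V) {K M s : ℤ} {n ℓ : ℕ} {h vα vβ s₀ s₁ : ℤ} (hK : 0 ≤ K) (hs : 0 ≤ s) (hM : 4 * K * s + 2 ≤ M)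
    (hn : M + 1 ≤ n) (hℓ : M + 1 ≤ ℓ) (hlay₁ : (M + 1) * ((n : ℤ) + |h|) ≤ (n : ℤ) * ((ℓ : ℤ) + 1)) (hv : |vα| ≤ (n : ℤ))
    (hlay : (n : ℤ) * ℓ - (n + |h|) < modulus n h vα vβ ∧ modulus n h vα vβ ≤ n * ℓ)
    {w w' : V} (h0 : |φ w 0 - φ w' 0| ≤ s) (h1 : |φ w 1 - φ w' 1| ≤ s) (i : Fin 2) :
    |coarseSkel φ t 800 n h vα vβ (20 * K) s₀ s₁ (detD 800 n h vα vβ) w i -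
        coarseSkel φ t 800 n h vα vβ (20 * K) s₀ s₁ (detD 800 n h vα vβ) w' i| ≤ 1 := by
  have hD : 0 < detD 800 n h vα vβ := by
    rw [detD]
    have : (0 : ℤ) < modulus n h vα vβ := by nlinarith [hlay.1, abs_nonneg h, hM, mul_nonneg hK hs]
    positivity
  have hM1 : K * s + 2 ≤ M := by nlinarith [mul_nonneg hK hs]
  have hL1 := hL1_of_floors hK hs hM1 hn hℓ hlay₁ hlay
  have hL0 := hL0_of_floors hK hs hM hn hℓ hlay₁ hv hlay
  exact coarse_containment t (by linarith) hD hL0 hL1 h0 h1 i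

end NegPrm

end Skelφ

end Summit.CriticalPhenomena.PercolationContinuityZ3.Theorems.Transplant
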